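import Literature.NumberTheory.Automorphic.ArchRankOneSplitCasimirJets            -- ★ p850889 (this seat) FILE 3: the Cayley bridge `casimirD_comp_cayley_eq`, `iterate_casimirD_comp_cayley_eq`, `iterate_casimirJ_mem`; brings ★ FILE 1∕2
import Literature.NumberTheory.Automorphic.ArchRankOneCasimirAllOrders             -- ★ p850669 (LH3-p04 (g4)) (ELL-∞) stage #2: `exists_tendsto_iteratedDeriv_even_orbitalIntegral_nhdsGT_nhdsLT`, `exists_tendsto_iteratedDeriv_odd_orbitalIntegral`
import Literature.NumberTheory.Automorphic.ArchRankOneJumpZeroCayley               -- ★ p850055 (LH10-p02): `integral_comp_conj_transport` (the torus point moves with the frame)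
import Literature.NumberTheory.Automorphic.ArchLocalRelabelTransport               -- ★ `isMulRightInvariant_map_continuousMulEquiv`
import HarnessLib

/-!
# (A0-CASIMIR-∞) FILE 4b: the ALL-ORDERS one-sided values of the normalised ELLIPTIC orbital integral on the generic carrier `U(J)`, `J = Φ₂`, in the CAYLEY frame and in
# terms of the SPLIT-frame Casimir `Ω_J` — ★ (ELL-∞) stage #2 transported along `Ad_P`, cones rewritten by the Cayley bridge (Varadarajan 1989 §6.4 Thm 24; Rogawski 1990 §8.2)

Topic `NumberTheory/Automorphic`; namespace `Literature.NumberTheory.Automorphic.UnitaryGroup`.  THEOREMS ONLY (no `def`, no instance, no notation, no axiom, no named fact, no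
`sorry`).  Cell `pub/hodgecm-mathlib`, crux H413 (`stmt-HodgeConjecture-24833`), line LH3 (closer stub `stub_N9`, direct road), letter L1∕L3′ pay-down brick **(A0-CASIMIR-∞)
FILE 4b** (F0P3a-p09 (g6); LH3-plan (g3) 2026-09-02T08:51:42Z «=» item (iii), elliptic entry of the junction).  ★ (ELL-∞) (LH3-p04 (g4), `ArchRankOneCasimirLadder`∕`AllOrders`)
is CONSUMED BY NAME; the order-0 version of this transport is ★ p850353 `exists_tendsto_two_sin_smul_orbitalIntegral_nhdsGT_nhdsLT_of_eq_over` (F0P3a-p07 (g16)), whose token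
shapes (Cayley torus point, explicit `P = (1 1; 1 −1)`, `P⁻¹ = ½P` in the cones) are kept VERBATIM so that ★ (J-CONST) `eq_of_hasOneSidedJump_cone` identifies the constant `C₁` with
the order-0 one; the (α2) dock ★ `ArchRankOneCasimirLadderCayley` (LH3-p01 (g4)) transports the stage-#1 heads to `U(Φ₂)_w` — here: stage #2 CLOSED FORMS, generic `U(J)`, cones of
`(1+Ω_J)ᵏ f` (split frame) instead of `(1+Ω_D)ᵏ (f ∘ Ad_P)`.

THE MATHEMATICS.  Frame witness: any number field `L` with a complex place `w` (the LH3 setting always has one); `a = (2, −2)`, `p = q = 1`, `σ_w diag(2,−2) = diag(2,−2) = P̄ᵀ J P`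
(★ `formCongr_cayleyTwo_of_eq_over`), so `e : h′ ↦ P h′ P⁻¹ : U(σ_w diag(2,−2)) ≃ₜ* U(J)` (★ `unitaryGroupOfFormCongrOfEq`).  For a Haar measure `ν` on `U(J)` (two-sided) put
`μ_D = e⁻¹_* ν`; then for every `g` and EVERY `ψ` (★ `integral_comp_conj_transport`)
  `F_g(ψ) := 2 sin ψ • ∫_{U(J)} g(↑↑(h · P t_z(ψ) P⁻¹ · h⁻¹)) dν = 2 sin ψ • ∫_{U(σ_w diag(2,−2))} (g ∘ Ad_P)(↑↑(h′ t_z(ψ) h′⁻¹)) dμ_D`,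
so ★ (ELL-∞)'s closed forms apply to `f ∘ Ad_P` (`C_c^∞` again) and the diagonal-frame Casimir `Ω_D`; their cone integrands `(1+Ω_D)ᵏ(f ∘ Ad_P)` equal `((1+Ω_J)ᵏ f) ∘ Ad_P`
(★ FILE 3 `iterate_casimirD_comp_cayley_eq`), and the engine's scalings `diag(√|e₀|, √|e₁|)^{∓1} = (√2)^{∓1}·1` cancel.  RESULT (§2): ONE `C₁ > 0` (★ (K0±)'s for `μ_D`) with, for all
`z ∈ S¹`, `f ∈ C_c^∞(M₂(ℂ), E)`, `k`:
  **`F_f⁽²ᵏ⁾ → (−1)ᵏ C₁ • cone⁺_P((1+Ω_J)ᵏ f, z)` (`ψ → 0⁺`), `→ (−1)ᵏ C₁ • −cone⁻_P((1+Ω_J)ᵏ f, z)` (`ψ → 0⁻`); `F_f⁽²ᵏ⁺¹⁾ → (−1)ᵏ C • ((1+Ω_J)ᵏ f)(z·1)` along `𝓝[≠] 0`**,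
`cone^±_P(g, z) = ∫_{τ>0, θ∈(0,2π]} g(P (z·1 ± τ diag(zi,−zi) + τ W_±(θ)) P⁻¹)` — ★ p850353's cones with `g = (1+Ω_J)ᵏ f`.

WHAT IS PROVED.
* §1 frame: `diagTwoNegTwo_frame` (side conditions of ★ (ELL-∞) at `a = (2,−2)`, `p = q = 1`), `map_embedding_diagonal_two_neg_two`, `exists_cayleyEquiv_diagonalL_of_eq_over`,
  `sqrtDiag_conj_eq_self` (the scalings cancel), `cayley_conj_smul_one` (`P (z·1) P⁻¹ = z·1`).
* §2 **`exists_tendsto_iteratedDeriv_even_orbitalIntegral_cayley_of_eq_over`**, **`exists_tendsto_iteratedDeriv_odd_orbitalIntegral_cayley_of_eq_over`**.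
HONEST LABEL: HC_CM is proved only modulo the 7 printed citations (2 remaining: hLiu418 = `stmt-HodgeConjecture-24832`, h413 = `stmt-HodgeConjecture-24833`) until rung 0 closes;
count-neutral, pays nothing by itself.

## References
* [Varadarajan1989] V. S. Varadarajan, *An Introduction to Harmonic Analysis on Semisimple Lie Groups*, Cambridge Stud. Adv. Math. 16 (1989), §6.4 Lemma 21 (c), Thms 23–24.
* [Rogawski1990] J. D. Rogawski, *Automorphic Representations of Unitary Groups in Three Variables*, Ann. of Math. Stud. 123 (1990), §8.2 pp. 119, 122 (the Cayley frame).
* [Shelstad1979] D. Shelstad, *Characters and inner forms of a quasi-split group over ℝ*, Compositio Math. 39 (1979), Lemma 4.3 p. 25, Prop. 4.5 p. 26.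
* [PlatonovRapinchuk1994] V. Platonov, A. Rapinchuk, *Algebraic Groups and Number Theory* (1994), §2.3 (change of frame for unitary groups).
* [Hall2015] B. C. Hall, *Lie Groups, Lie Algebras, and Representations*, GTM 222 (2015), §3.6, Prop. 3.24.
-/

set_option autoImplicit false

noncomputable section

open MeasureTheory Measure Set Filter Topology Complex NumberField NumberField.InfinitePlace
open scoped ENNReal NNReal ComplexConjugate ContDiff Matrix.Norms.Operator MatrixGroups Real

namespace Literature.NumberTheory.Automorphic

namespace UnitaryGroup

open Literature.NumberTheory.Automorphic.RankOneCasimir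

/-! ## §1 Frame bookkeeping at `a = (2, −2)`, `p = q = 1` -/

section Frame

variable (L : Type) [Field L] [NumberField L] (w : {w : InfinitePlace L // IsComplex w})

/-- The side conditions of ★ (ELL-∞) at `a = (2, −2)`, `p = q = 1`: `a_i ≠ 0`, `σ_w(a_i)` real, `re σ_w(2) · re σ_w(−2) < 0`, `1² · σ_w(−2) = −σ_w(2)` (the hyperbolic signature `(2,−2) = P̄ᵀ Φ₂ P`). [cite: Rogawski1990, §8.2 p. 122] -/
theorem diagTwoNegTwo_frame :
    (∀ i, (![(2 : L), -2]) i ≠ 0) ∧ (∀ i, (w.1.embedding ((![(2 : L), -2]) i)).im = 0) ∧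
      (w.1.embedding ((![(2 : L), -2]) 0)).re * (w.1.embedding ((![(2 : L), -2]) 1)).re < 0 ∧
      ((1 : ℝ) : ℂ) ^ 2 * w.1.embedding ((![(2 : L), -2]) 1) = -w.1.embedding ((![(2 : L), -2]) 0) := by
  -- adapted from ★ `ArchRankOneCasimirLadderCayley` (private `cayleyDiag_frame`, LH3-p01 (g4))
  have h0 : w.1.embedding ((![(2 : L), -2]) 0) = 2 := by
    rw [show (![(2 : L), -2]) 0 = 2 from rfl, map_ofNat]
  have h1 : w.1.embedding ((![(2 : L), -2]) 1) = -2 := by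
    rw [show (![(2 : L), -2]) 1 = -2 from rfl, map_neg, map_ofNat]
  refine ⟨fun i => ?_, fun i => ?_, ?_, ?_⟩
  · fin_cases i
    · show (![(2 : L), -2]) 0 ≠ 0
      rw [show (![(2 : L), -2]) 0 = 2 from rfl]; exact two_ne_zero
    · show (![(2 : L), -2]) 1 ≠ 0
      rw [show (![(2 : L), -2]) 1 = -2 from rfl]; exact neg_ne_zero.2 two_ne_zero
  · fin_cases i
    · show (w.1.embedding ((![(2 : L), -2]) 0)).im = 0
      rw [h0]; norm_num
    · show (w.1.embedding ((![(2 : L), -2]) 1)).im = 0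
      rw [h1]; norm_num
  · rw [h0, h1]; norm_num
  · rw [h0, h1]; norm_num

/-- `σ_w diag(2, −2) = diag(2, −2)` (the form `P̄ᵀ Φ₂ P` is rational). [cite: Rogawski1990, §8.2 p. 122] -/
theorem map_embedding_diagonal_two_neg_two : (Matrix.diagonal ![(2 : L), -2]).map w.1.embedding = Matrix.diagonal ![(2 : ℂ), -2] := by
  rw [Matrix.diagonal_map (map_zero _)]
  congr 1
  funext i
  fin_cases i
  · show w.1.embedding 2 = 2
    rw [map_ofNat]
  · show w.1.embedding (-2) = -2
    rw [map_neg, map_ofNat]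

/-- **The engine's scalings cancel at `a = (2,−2)`**: `diag(√|e₀|, √|e₁|)⁻¹ · X · diag(√|e₀|, √|e₁|) = X` (`|e₀| = |e₁| = 2`: both factors are the scalars `(√2)^{∓1}`). [cite: Varadarajan1989, §6.4 Lemma 21 (c)] -/
theorem sqrtDiag_conj_eq_self (X : Matrix (Fin 2) (Fin 2) ℂ) :
    Matrix.diagonal ![(((Real.sqrt |(w.1.embedding (![(2 : L), -2] 0)).re|)⁻¹ : ℝ) : ℂ), (((Real.sqrt |(w.1.embedding (![(2 : L), -2] 1)).re|)⁻¹ : ℝ) : ℂ)] * X * Matrix.diagonal ![((Real.sqrt |(w.1.embedding (![(2 : L), -2] 0)).re| : ℝ) : ℂ), ((Real.sqrt |(w.1.embedding (![(2 : L), -2] 1)).re| : ℝ) : ℂ)] = X := by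
  have h0 : (w.1.embedding ((![(2 : L), -2]) 0)).re = 2 := by
    rw [show (![(2 : L), -2]) 0 = 2 from rfl, map_ofNat]; norm_num
  have h1 : (w.1.embedding ((![(2 : L), -2]) 1)).re = -2 := by
    rw [show (![(2 : L), -2]) 1 = -2 from rfl, map_neg, map_ofNat]; norm_num
  rw [h0, h1, abs_neg, abs_two]
  have hs : ((Real.sqrt 2 : ℝ) : ℂ) ≠ 0 := Complex.ofReal_ne_zero.2 (Real.sqrt_ne_zero'.2 two_pos)
  have hL : Matrix.diagonal ![(((Real.sqrt 2)⁻¹ : ℝ) : ℂ), (((Real.sqrt 2)⁻¹ : ℝ) : ℂ)] = (((Real.sqrt 2 : ℝ) : ℂ))⁻¹ • (1 : Matrix (Fin 2) (Fin 2) ℂ) := by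
    rw [Matrix.smul_one_eq_diagonal]
    congr 1; funext i; fin_cases i <;> simp [Complex.ofReal_inv]
  have hR : Matrix.diagonal ![((Real.sqrt 2 : ℝ) : ℂ), ((Real.sqrt 2 : ℝ) : ℂ)] = ((Real.sqrt 2 : ℝ) : ℂ) • (1 : Matrix (Fin 2) (Fin 2) ℂ) := by
    rw [Matrix.smul_one_eq_diagonal]
    congr 1; funext i; fin_cases i <;> simp
  rw [hL, hR, Matrix.smul_mul, Matrix.one_mul, Matrix.mul_smul, Matrix.mul_one, smul_smul, mul_inv_cancel₀ hs, one_smul]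

/-- `P (z·1) P⁻¹ = z·1` (the centre is fixed by the change of frame). [cite: Rogawski1990, §8.2 p. 122] -/
theorem cayley_conj_smul_one (z : ℂ) : (((Matrix.GeneralLinearGroup.mkOfDetNeZero !![(1 : ℂ), 1; 1, -1] det_cayleyTwo_ne_zero) : GL (Fin 2) ℂ) : Matrix (Fin 2) (Fin 2) ℂ) * (z • (1 : Matrix (Fin 2) (Fin 2) ℂ)) * ((((Matrix.GeneralLinearGroup.mkOfDetNeZero !![(1 : ℂ), 1; 1, -1] det_cayleyTwo_ne_zero))⁻¹ : GL (Fin 2) ℂ) : Matrix (Fin 2) (Fin 2) ℂ) = z • (1 : Matrix (Fin 2) (Fin 2) ℂ) := by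
  rw [Matrix.mul_smul, Matrix.mul_one, Matrix.smul_mul, ← Units.val_mul, mul_inv_cancel, Units.val_one]

/-- `X ↦ f(P X P⁻¹)` is `C_c^∞` when `f` is (`Ad_P` is a linear homeomorphism of `M₂(ℂ)`; ★ FILE 3 `exists_continuousLinearEquiv_matrixConj`). [cite: Hall2015, §3.6, Prop. 3.24] -/
theorem contDiff_hasCompactSupport_comp_cayleyGL {E : Type*} [NormedAddCommGroup E] [NormedSpace ℝ E] {f : Matrix (Fin 2) (Fin 2) ℂ → E}
    (hf : ContDiff ℝ ∞ f) (hfc : HasCompactSupport f) :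
    ContDiff ℝ ∞ (fun X : Matrix (Fin 2) (Fin 2) ℂ => f ((((Matrix.GeneralLinearGroup.mkOfDetNeZero !![(1 : ℂ), 1; 1, -1] det_cayleyTwo_ne_zero) : GL (Fin 2) ℂ) : Matrix (Fin 2) (Fin 2) ℂ) * X * ((((Matrix.GeneralLinearGroup.mkOfDetNeZero !![(1 : ℂ), 1; 1, -1] det_cayleyTwo_ne_zero))⁻¹ : GL (Fin 2) ℂ) : Matrix (Fin 2) (Fin 2) ℂ))) ∧ HasCompactSupport (fun X : Matrix (Fin 2) (Fin 2) ℂ => f ((((Matrix.GeneralLinearGroup.mkOfDetNeZero !![(1 : ℂ), 1; 1, -1] det_cayleyTwo_ne_zero) : GL (Fin 2) ℂ) : Matrix (Fin 2) (Fin 2) ℂ) * X * ((((Matrix.GeneralLinearGroup.mkOfDetNeZero !![(1 : ℂ), 1; 1, -1] det_cayleyTwo_ne_zero))⁻¹ : GL (Fin 2) ℂ) : Matrix (Fin 2) (Fin 2) ℂ))) := by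
  refine ⟨hf.comp ((contDiff_const.mul contDiff_id).mul contDiff_const), ?_⟩
  obtain ⟨A, hA⟩ := exists_continuousLinearEquiv_matrixConj (Matrix.GeneralLinearGroup.mkOfDetNeZero !![(1 : ℂ), 1; 1, -1] det_cayleyTwo_ne_zero)
  have h := hfc.comp_homeomorph A.toHomeomorph
  have e : f ∘ ⇑A.toHomeomorph = fun X => f ((((Matrix.GeneralLinearGroup.mkOfDetNeZero !![(1 : ℂ), 1; 1, -1] det_cayleyTwo_ne_zero) : GL (Fin 2) ℂ) : Matrix (Fin 2) (Fin 2) ℂ) * X * ((((Matrix.GeneralLinearGroup.mkOfDetNeZero !![(1 : ℂ), 1; 1, -1] det_cayleyTwo_ne_zero))⁻¹ : GL (Fin 2) ℂ) : Matrix (Fin 2) (Fin 2) ℂ)) := funext fun X => by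
    rw [Function.comp_apply, ContinuousLinearEquiv.coe_toHomeomorph, hA]
  rwa [e] at h

variable {J : Matrix (Fin 2) (Fin 2) ℂ} (hJ : J = (StdForm.antidiagonal 2).over ℂ)

include hJ in
/-- **The Cayley congruence `h′ ↦ P h′ P⁻¹ : U(σ_w diag(2,−2))(ℂ) ≃ₜ* U(J)`** with its value formula — the domain is LITERALLY ★ (ELL-∞)'s carrier at `a = (2,−2)`, the target the
generic `U(J)` of ★ (A0-b)∕(K0±-FORM-TRANSPORT). [cite: Rogawski1990, §8.2 p. 122] [cite: PlatonovRapinchuk1994, §2.3] -/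
theorem exists_cayleyEquiv_diagonalL_of_eq_over :
    ∃ e : ↥(unitaryGroupOfForm (starRingEnd ℂ) ((Matrix.diagonal ![(2 : L), -2]).map w.1.embedding)) ≃ₜ* ↥(unitaryGroupOfForm (starRingEnd ℂ) J), ∀ h' : ↥(unitaryGroupOfForm (starRingEnd ℂ) ((Matrix.diagonal ![(2 : L), -2]).map w.1.embedding)), ((e h' : ↥(unitaryGroupOfForm (starRingEnd ℂ) J)) : GL (Fin 2) ℂ) = (Matrix.GeneralLinearGroup.mkOfDetNeZero !![(1 : ℂ), 1; 1, -1] det_cayleyTwo_ne_zero) * (h' : GL (Fin 2) ℂ) * ((Matrix.GeneralLinearGroup.mkOfDetNeZero !![(1 : ℂ), 1; 1, -1] det_cayleyTwo_ne_zero))⁻¹ :=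
  ⟨unitaryGroupOfFormCongrOfEq (starRingEnd ℂ) (Matrix.GeneralLinearGroup.mkOfDetNeZero !![(1 : ℂ), 1; 1, -1] det_cayleyTwo_ne_zero) _ _ ((formCongr_cayleyTwo_of_eq_over hJ).trans (map_embedding_diagonal_two_neg_two L w).symm),
    fun _ => rfl⟩

end Frame

/-! ## §2 The all-orders one-sided values on `U(J)` in the Cayley frame, cones of `(1+Ω_J)ᵏ f` -/

section Heads

variable (L : Type) [Field L] [NumberField L] (w : {w : InfinitePlace L // IsComplex w})
  {J : Matrix (Fin 2) (Fin 2) ℂ} (hJ : J = (StdForm.antidiagonal 2).over ℂ)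
  [MeasurableSpace ↥(unitaryGroupOfForm (starRingEnd ℂ) J)] [BorelSpace ↥(unitaryGroupOfForm (starRingEnd ℂ) J)]
  (ν : Measure ↥(unitaryGroupOfForm (starRingEnd ℂ) J)) [ν.IsHaarMeasure] [ν.IsMulRightInvariant]
  {E : Type*} [NormedAddCommGroup E] [NormedSpace ℝ E] [CompleteSpace E]

include L w hJ in
/-- **EVEN JETS OF THE NORMALISED ELLIPTIC ORBITAL INTEGRAL ON `U(J)`: THE ONE-SIDED VALUES AT THE CENTRAL WALL, ALL ORDERS, SPLIT-FRAME CASIMIR.**  For every two-sided Haar `ν` on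
`U(J)` ONE `C₁ > 0` such that for every `z ∈ S¹`, every family `F` bound by `hF` (`F_g(ψ) = 2 sin ψ • ∫_{U(J)} g(↑↑(h · P t_z(ψ) P⁻¹ · h⁻¹)) dν`, ★ p850353's token shape), every
`f ∈ C_c^∞(M₂(ℂ), E)` and `k`: **`F_f⁽²ᵏ⁾ → (−1)ᵏ • C₁ • cone⁺_P((1+Ω_J)ᵏ f, z)` along `𝓝[>] 0` and `→ (−1)ᵏ • C₁ • −cone⁻_P((1+Ω_J)ᵏ f, z)` along `𝓝[<] 0`** — ★ (ELL-∞)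
`exists_tendsto_iteratedDeriv_even_orbitalIntegral_nhdsGT_nhdsLT` (LH3-p04 (g4)) at `a = (2,−2)` for `e⁻¹_* ν` and `f ∘ Ad_P`, read back through ★ `integral_comp_conj_transport` and the
bridge ★ `iterate_casimirD_comp_cayley_eq`.  At `k = 0` this is ★ p850353's order-0 statement token for token (so ★ `eq_of_hasOneSidedJump_cone` identifies `C₁`).
[cite: Varadarajan1989, §6.4 Lemma 21 (c), Thms 23–24] [cite: Shelstad1979, Lemma 4.3 p. 25] [cite: Rogawski1990, §8.2 pp. 119, 122] -/
theorem exists_tendsto_iteratedDeriv_even_orbitalIntegral_cayley_of_eq_over (ΩJ : (Matrix (Fin 2) (Fin 2) ℂ → E) → Matrix (Fin 2) (Fin 2) ℂ → E)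
    (hΩJ : ∀ (g : Matrix (Fin 2) (Fin 2) ℂ → E) (Y : Matrix (Fin 2) (Fin 2) ℂ), ΩJ g Y =
      -(fderiv ℝ (fderiv ℝ g) Y (Y * !![0, I; I, 0]) (Y * !![0, I; I, 0]) + fderiv ℝ g Y (Y * !![0, I; I, 0] * !![0, I; I, 0])) +
        (fderiv ℝ (fderiv ℝ g) Y (Y * !![1, 0; 0, -1]) (Y * !![1, 0; 0, -1]) + fderiv ℝ g Y (Y * !![1, 0; 0, -1] * !![1, 0; 0, -1])) +
        (fderiv ℝ (fderiv ℝ g) Y (Y * !![0, I; -I, 0]) (Y * !![0, I; -I, 0]) + fderiv ℝ g Y (Y * !![0, I; -I, 0] * !![0, I; -I, 0]))) :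
    ∃ C₁ : ℝ, 0 < C₁ ∧ ∀ (z : Circle) (F : (Matrix (Fin 2) (Fin 2) ℂ → E) → ℝ → E)
      (hF : ∀ (g : Matrix (Fin 2) (Fin 2) ℂ → E) (ψ : ℝ), F g ψ = (2 * Real.sin ψ) •
        ∫ h : ↥(unitaryGroupOfForm (starRingEnd ℂ) J), g (((h * (⟨(Matrix.GeneralLinearGroup.mkOfDetNeZero !![(1 : ℂ), 1; 1, -1] det_cayleyTwo_ne_zero) * circleDiagonal 2 ![z * Circle.exp ψ, z * Circle.exp (-ψ)] * ((Matrix.GeneralLinearGroup.mkOfDetNeZero !![(1 : ℂ), 1; 1, -1] det_cayleyTwo_ne_zero))⁻¹, cayley_conj_circleDiagonal_mem_of_eq_over hJ _⟩ : ↥(unitaryGroupOfForm (starRingEnd ℂ) J)) * h⁻¹ : ↥(unitaryGroupOfForm (starRingEnd ℂ) J)) : GL (Fin 2) ℂ) : Matrix (Fin 2) (Fin 2) ℂ) ∂ν)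
      {f : Matrix (Fin 2) (Fin 2) ℂ → E}, ContDiff ℝ ∞ f → HasCompactSupport f → ∀ k : ℕ,
        Tendsto (fun ψ => iteratedDeriv (2 * k) (F f) ψ) (𝓝[>] 0)
          (𝓝 (((-1 : ℝ) ^ k) • C₁ • ∫ p in Ioi (0 : ℝ) ×ˢ Ioc (0 : ℝ) (2 * π),
              ((fun g => g + ΩJ g)^[k] f) ((!![(1 : ℂ), 1; 1, -1] : Matrix (Fin 2) (Fin 2) ℂ) *
                ((z : ℂ) • (1 : Matrix (Fin 2) (Fin 2) ℂ) + p.1 • Matrix.diagonal ![(z : ℂ) * I, -((z : ℂ) * I)] +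
                  p.1 • !![(0 : ℂ), -((z : ℂ) * I) * cexp (-((p.2 : ℂ) * I)); ((z : ℂ) * I) * cexp ((p.2 : ℂ) * I), 0]) *
                !![(1 / 2 : ℂ), 1 / 2; 1 / 2, -(1 / 2)]))) ∧
        Tendsto (fun ψ => iteratedDeriv (2 * k) (F f) ψ) (𝓝[<] 0)
          (𝓝 (((-1 : ℝ) ^ k) • C₁ • -(∫ p in Ioi (0 : ℝ) ×ˢ Ioc (0 : ℝ) (2 * π),
              ((fun g => g + ΩJ g)^[k] f) ((!![(1 : ℂ), 1; 1, -1] : Matrix (Fin 2) (Fin 2) ℂ) *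
                ((z : ℂ) • (1 : Matrix (Fin 2) (Fin 2) ℂ) + p.1 • Matrix.diagonal ![-((z : ℂ) * I), (z : ℂ) * I] +
                  p.1 • !![(0 : ℂ), ((z : ℂ) * I) * cexp (-((p.2 : ℂ) * I)); -((z : ℂ) * I) * cexp ((p.2 : ℂ) * I), 0]) *
                !![(1 / 2 : ℂ), 1 / 2; 1 / 2, -(1 / 2)])))) := by
  obtain ⟨e, he⟩ := exists_cayleyEquiv_diagonalL_of_eq_over L w hJ
  letI : MeasurableSpace ↥(unitaryGroupOfForm (starRingEnd ℂ) ((Matrix.diagonal ![(2 : L), -2]).map w.1.embedding)) := borel _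
  haveI : BorelSpace ↥(unitaryGroupOfForm (starRingEnd ℂ) ((Matrix.diagonal ![(2 : L), -2]).map w.1.embedding)) := ⟨rfl⟩
  haveI : (ν.map e.symm).IsHaarMeasure := e.symm.isHaarMeasure_map ν
  haveI : (ν.map e.symm).IsMulRightInvariant := isMulRightInvariant_map_continuousMulEquiv e.symm ν
  obtain ⟨ha, hreal, hsgn, hqe⟩ := diagTwoNegTwo_frame L w
  obtain ⟨ΩD, hΩD⟩ : ∃ ΩD : (Matrix (Fin 2) (Fin 2) ℂ → E) → Matrix (Fin 2) (Fin 2) ℂ → E, ∀ (g : Matrix (Fin 2) (Fin 2) ℂ → E) (Y : Matrix (Fin 2) (Fin 2) ℂ), ΩD g Y =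
      -(fderiv ℝ (fderiv ℝ g) Y (Y * !![I, 0; 0, -I]) (Y * !![I, 0; 0, -I]) + fderiv ℝ g Y (Y * !![I, 0; 0, -I] * !![I, 0; 0, -I])) +
        (fderiv ℝ (fderiv ℝ g) Y (Y * !![(0 : ℂ), ((1 : ℝ) : ℂ); ((1 : ℝ) : ℂ), 0]) (Y * !![(0 : ℂ), ((1 : ℝ) : ℂ); ((1 : ℝ) : ℂ), 0]) +
          fderiv ℝ g Y (Y * !![(0 : ℂ), ((1 : ℝ) : ℂ); ((1 : ℝ) : ℂ), 0] * !![(0 : ℂ), ((1 : ℝ) : ℂ); ((1 : ℝ) : ℂ), 0])) +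
        (fderiv ℝ (fderiv ℝ g) Y (Y * !![(0 : ℂ), -(((1 : ℝ) : ℂ) * I); ((1 : ℝ) : ℂ) * I, 0]) (Y * !![(0 : ℂ), -(((1 : ℝ) : ℂ) * I); ((1 : ℝ) : ℂ) * I, 0]) +
          fderiv ℝ g Y (Y * !![(0 : ℂ), -(((1 : ℝ) : ℂ) * I); ((1 : ℝ) : ℂ) * I, 0] * !![(0 : ℂ), -(((1 : ℝ) : ℂ) * I); ((1 : ℝ) : ℂ) * I, 0])) := ⟨fun g Y => _, fun g Y => rfl⟩
  obtain ⟨C₁, hC₁, hev⟩ := exists_tendsto_iteratedDeriv_even_orbitalIntegral_nhdsGT_nhdsLT (E := E) L (![(2 : L), -2]) w ha hreal hsgn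
    (p := 1) (q := 1) (by norm_num) hqe (ν.map e.symm) ΩD hΩD
  refine ⟨C₁, hC₁, fun z F hF f hf hfc k => ?_⟩
  -- the transported family on the diagonal-frame carrier and the transported test function
  obtain ⟨FD, hFD⟩ : ∃ FD : (Matrix (Fin 2) (Fin 2) ℂ → E) → ℝ → E, ∀ (g : Matrix (Fin 2) (Fin 2) ℂ → E) (ψ : ℝ), FD g ψ = (2 * Real.sin ψ) •
      ∫ h' : ↥(unitaryGroupOfForm (starRingEnd ℂ) ((Matrix.diagonal ![(2 : L), -2]).map w.1.embedding)), g (((h' * (⟨circleDiagonal 2 ![z * Circle.exp ψ, z * Circle.exp (-ψ)], circleDiagonal_mem_archLocal_diagonal L 2 ![(2 : L), -2] w _⟩ : ↥(unitaryGroupOfForm (starRingEnd ℂ) ((Matrix.diagonal ![(2 : L), -2]).map w.1.embedding))) * h'⁻¹ : ↥(unitaryGroupOfForm (starRingEnd ℂ) ((Matrix.diagonal ![(2 : L), -2]).map w.1.embedding))) : GL (Fin 2) ℂ) : Matrix (Fin 2) (Fin 2) ℂ) ∂(ν.map e.symm) :=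
    ⟨fun g ψ => _, fun _ _ => rfl⟩
  obtain ⟨hfP, hfPc⟩ := contDiff_hasCompactSupport_comp_cayleyGL hf hfc
  have hFF : F f = FD (fun X => f ((((Matrix.GeneralLinearGroup.mkOfDetNeZero !![(1 : ℂ), 1; 1, -1] det_cayleyTwo_ne_zero) : GL (Fin 2) ℂ) : Matrix (Fin 2) (Fin 2) ℂ) * X * ((((Matrix.GeneralLinearGroup.mkOfDetNeZero !![(1 : ℂ), 1; 1, -1] det_cayleyTwo_ne_zero))⁻¹ : GL (Fin 2) ℂ) : Matrix (Fin 2) (Fin 2) ℂ))) := by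
    funext ψ
    rw [hF]
    rw [hFD]
    have hγ : (⟨(Matrix.GeneralLinearGroup.mkOfDetNeZero !![(1 : ℂ), 1; 1, -1] det_cayleyTwo_ne_zero) * circleDiagonal 2 ![z * Circle.exp ψ, z * Circle.exp (-ψ)] * ((Matrix.GeneralLinearGroup.mkOfDetNeZero !![(1 : ℂ), 1; 1, -1] det_cayleyTwo_ne_zero))⁻¹, cayley_conj_circleDiagonal_mem_of_eq_over hJ _⟩ : ↥(unitaryGroupOfForm (starRingEnd ℂ) J)) = e (⟨circleDiagonal 2 ![z * Circle.exp ψ, z * Circle.exp (-ψ)], circleDiagonal_mem_archLocal_diagonal L 2 ![(2 : L), -2] w _⟩ : ↥(unitaryGroupOfForm (starRingEnd ℂ) ((Matrix.diagonal ![(2 : L), -2]).map w.1.embedding))) :=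
      Subtype.ext (he (⟨circleDiagonal 2 ![z * Circle.exp ψ, z * Circle.exp (-ψ)], circleDiagonal_mem_archLocal_diagonal L 2 ![(2 : L), -2] w _⟩ : ↥(unitaryGroupOfForm (starRingEnd ℂ) ((Matrix.diagonal ![(2 : L), -2]).map w.1.embedding)))).symm
    rw [hγ, integral_comp_conj_transport _ _ e _ he ν f (⟨circleDiagonal 2 ![z * Circle.exp ψ, z * Circle.exp (-ψ)], circleDiagonal_mem_archLocal_diagonal L 2 ![(2 : L), -2] w _⟩ : ↥(unitaryGroupOfForm (starRingEnd ℂ) ((Matrix.diagonal ![(2 : L), -2]).map w.1.embedding)))]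
  obtain ⟨hGT, hLT⟩ := hev z FD hFD hfP hfPc k
  rw [← hFF] at hGT hLT
  have hit := iterate_casimirD_comp_cayley_eq ΩD ΩJ hΩD hΩJ hf hfc k
  simp only [hit, sqrtDiag_conj_eq_self] at hGT hLT
  rw [Matrix.GeneralLinearGroup.val_mkOfDetNeZero, coe_inv_cayleyTwo] at hGT hLT
  exact ⟨hGT, hLT⟩

include L w hJ in
/-- **ODD JETS OF THE NORMALISED ELLIPTIC ORBITAL INTEGRAL ON `U(J)` ARE CONTINUOUS AT THE CENTRAL WALL, WITH THEIR VALUES** (no jump at odd orders): ONE `C ≠ 0` with, for every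
`z ∈ S¹`, `F` bound by `hF`, `f ∈ C_c^∞(M₂(ℂ), E)` and `k`, **`F_f⁽²ᵏ⁺¹⁾ → (−1)ᵏ • C • ((1+Ω_J)ᵏ f)(z·1)` along `𝓝[≠] 0`** — ★ (ELL-∞) `exists_tendsto_iteratedDeriv_odd_orbitalIntegral`
transported (`((1+Ω_J)ᵏ f)(P (z·1) P⁻¹) = ((1+Ω_J)ᵏ f)(z·1)`). [cite: Varadarajan1989, §6.4 Thm 24] [cite: Shelstad1979, Prop. 4.5 p. 26] -/
theorem exists_tendsto_iteratedDeriv_odd_orbitalIntegral_cayley_of_eq_over (ΩJ : (Matrix (Fin 2) (Fin 2) ℂ → E) → Matrix (Fin 2) (Fin 2) ℂ → E)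
    (hΩJ : ∀ (g : Matrix (Fin 2) (Fin 2) ℂ → E) (Y : Matrix (Fin 2) (Fin 2) ℂ), ΩJ g Y =
      -(fderiv ℝ (fderiv ℝ g) Y (Y * !![0, I; I, 0]) (Y * !![0, I; I, 0]) + fderiv ℝ g Y (Y * !![0, I; I, 0] * !![0, I; I, 0])) +
        (fderiv ℝ (fderiv ℝ g) Y (Y * !![1, 0; 0, -1]) (Y * !![1, 0; 0, -1]) + fderiv ℝ g Y (Y * !![1, 0; 0, -1] * !![1, 0; 0, -1])) +
        (fderiv ℝ (fderiv ℝ g) Y (Y * !![0, I; -I, 0]) (Y * !![0, I; -I, 0]) + fderiv ℝ g Y (Y * !![0, I; -I, 0] * !![0, I; -I, 0]))) :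
    ∃ C : ℝ, C ≠ 0 ∧ ∀ (z : Circle) (F : (Matrix (Fin 2) (Fin 2) ℂ → E) → ℝ → E)
      (hF : ∀ (g : Matrix (Fin 2) (Fin 2) ℂ → E) (ψ : ℝ), F g ψ = (2 * Real.sin ψ) •
        ∫ h : ↥(unitaryGroupOfForm (starRingEnd ℂ) J), g (((h * (⟨(Matrix.GeneralLinearGroup.mkOfDetNeZero !![(1 : ℂ), 1; 1, -1] det_cayleyTwo_ne_zero) * circleDiagonal 2 ![z * Circle.exp ψ, z * Circle.exp (-ψ)] * ((Matrix.GeneralLinearGroup.mkOfDetNeZero !![(1 : ℂ), 1; 1, -1] det_cayleyTwo_ne_zero))⁻¹, cayley_conj_circleDiagonal_mem_of_eq_over hJ _⟩ : ↥(unitaryGroupOfForm (starRingEnd ℂ) J)) * h⁻¹ : ↥(unitaryGroupOfForm (starRingEnd ℂ) J)) : GL (Fin 2) ℂ) : Matrix (Fin 2) (Fin 2) ℂ) ∂ν)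
      {f : Matrix (Fin 2) (Fin 2) ℂ → E}, ContDiff ℝ ∞ f → HasCompactSupport f → ∀ k : ℕ,
        Tendsto (fun ψ => iteratedDeriv (2 * k + 1) (F f) ψ) (𝓝[≠] 0)
          (𝓝 (((-1 : ℝ) ^ k) • C • ((fun g => g + ΩJ g)^[k] f) ((z : ℂ) • (1 : Matrix (Fin 2) (Fin 2) ℂ)))) := by
  obtain ⟨e, he⟩ := exists_cayleyEquiv_diagonalL_of_eq_over L w hJ
  letI : MeasurableSpace ↥(unitaryGroupOfForm (starRingEnd ℂ) ((Matrix.diagonal ![(2 : L), -2]).map w.1.embedding)) := borel _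
  haveI : BorelSpace ↥(unitaryGroupOfForm (starRingEnd ℂ) ((Matrix.diagonal ![(2 : L), -2]).map w.1.embedding)) := ⟨rfl⟩
  haveI : (ν.map e.symm).IsHaarMeasure := e.symm.isHaarMeasure_map ν
  haveI : (ν.map e.symm).IsMulRightInvariant := isMulRightInvariant_map_continuousMulEquiv e.symm ν
  obtain ⟨ha, hreal, hsgn, hqe⟩ := diagTwoNegTwo_frame L w
  obtain ⟨ΩD, hΩD⟩ : ∃ ΩD : (Matrix (Fin 2) (Fin 2) ℂ → E) → Matrix (Fin 2) (Fin 2) ℂ → E, ∀ (g : Matrix (Fin 2) (Fin 2) ℂ → E) (Y : Matrix (Fin 2) (Fin 2) ℂ), ΩD g Y =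
      -(fderiv ℝ (fderiv ℝ g) Y (Y * !![I, 0; 0, -I]) (Y * !![I, 0; 0, -I]) + fderiv ℝ g Y (Y * !![I, 0; 0, -I] * !![I, 0; 0, -I])) +
        (fderiv ℝ (fderiv ℝ g) Y (Y * !![(0 : ℂ), ((1 : ℝ) : ℂ); ((1 : ℝ) : ℂ), 0]) (Y * !![(0 : ℂ), ((1 : ℝ) : ℂ); ((1 : ℝ) : ℂ), 0]) +
          fderiv ℝ g Y (Y * !![(0 : ℂ), ((1 : ℝ) : ℂ); ((1 : ℝ) : ℂ), 0] * !![(0 : ℂ), ((1 : ℝ) : ℂ); ((1 : ℝ) : ℂ), 0])) +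
        (fderiv ℝ (fderiv ℝ g) Y (Y * !![(0 : ℂ), -(((1 : ℝ) : ℂ) * I); ((1 : ℝ) : ℂ) * I, 0]) (Y * !![(0 : ℂ), -(((1 : ℝ) : ℂ) * I); ((1 : ℝ) : ℂ) * I, 0]) +
          fderiv ℝ g Y (Y * !![(0 : ℂ), -(((1 : ℝ) : ℂ) * I); ((1 : ℝ) : ℂ) * I, 0] * !![(0 : ℂ), -(((1 : ℝ) : ℂ) * I); ((1 : ℝ) : ℂ) * I, 0])) := ⟨fun g Y => _, fun g Y => rfl⟩
  obtain ⟨C, hC, hodd⟩ := exists_tendsto_iteratedDeriv_odd_orbitalIntegral (E := E) L (![(2 : L), -2]) w ha hreal hsgn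
    (p := 1) (q := 1) (by norm_num) hqe (ν.map e.symm) ΩD hΩD
  refine ⟨C, hC, fun z F hF f hf hfc k => ?_⟩
  obtain ⟨FD, hFD⟩ : ∃ FD : (Matrix (Fin 2) (Fin 2) ℂ → E) → ℝ → E, ∀ (g : Matrix (Fin 2) (Fin 2) ℂ → E) (ψ : ℝ), FD g ψ = (2 * Real.sin ψ) •
      ∫ h' : ↥(unitaryGroupOfForm (starRingEnd ℂ) ((Matrix.diagonal ![(2 : L), -2]).map w.1.embedding)), g (((h' * (⟨circleDiagonal 2 ![z * Circle.exp ψ, z * Circle.exp (-ψ)], circleDiagonal_mem_archLocal_diagonal L 2 ![(2 : L), -2] w _⟩ : ↥(unitaryGroupOfForm (starRingEnd ℂ) ((Matrix.diagonal ![(2 : L), -2]).map w.1.embedding))) * h'⁻¹ : ↥(unitaryGroupOfForm (starRingEnd ℂ) ((Matrix.diagonal ![(2 : L), -2]).map w.1.embedding))) : GL (Fin 2) ℂ) : Matrix (Fin 2) (Fin 2) ℂ) ∂(ν.map e.symm) :=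
    ⟨fun g ψ => _, fun _ _ => rfl⟩
  obtain ⟨hfP, hfPc⟩ := contDiff_hasCompactSupport_comp_cayleyGL hf hfc
  have hFF : F f = FD (fun X => f ((((Matrix.GeneralLinearGroup.mkOfDetNeZero !![(1 : ℂ), 1; 1, -1] det_cayleyTwo_ne_zero) : GL (Fin 2) ℂ) : Matrix (Fin 2) (Fin 2) ℂ) * X * ((((Matrix.GeneralLinearGroup.mkOfDetNeZero !![(1 : ℂ), 1; 1, -1] det_cayleyTwo_ne_zero))⁻¹ : GL (Fin 2) ℂ) : Matrix (Fin 2) (Fin 2) ℂ))) := by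
    funext ψ
    rw [hF]
    rw [hFD]
    have hγ : (⟨(Matrix.GeneralLinearGroup.mkOfDetNeZero !![(1 : ℂ), 1; 1, -1] det_cayleyTwo_ne_zero) * circleDiagonal 2 ![z * Circle.exp ψ, z * Circle.exp (-ψ)] * ((Matrix.GeneralLinearGroup.mkOfDetNeZero !![(1 : ℂ), 1; 1, -1] det_cayleyTwo_ne_zero))⁻¹, cayley_conj_circleDiagonal_mem_of_eq_over hJ _⟩ : ↥(unitaryGroupOfForm (starRingEnd ℂ) J)) = e (⟨circleDiagonal 2 ![z * Circle.exp ψ, z * Circle.exp (-ψ)], circleDiagonal_mem_archLocal_diagonal L 2 ![(2 : L), -2] w _⟩ : ↥(unitaryGroupOfForm (starRingEnd ℂ) ((Matrix.diagonal ![(2 : L), -2]).map w.1.embedding))) :=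
      Subtype.ext (he (⟨circleDiagonal 2 ![z * Circle.exp ψ, z * Circle.exp (-ψ)], circleDiagonal_mem_archLocal_diagonal L 2 ![(2 : L), -2] w _⟩ : ↥(unitaryGroupOfForm (starRingEnd ℂ) ((Matrix.diagonal ![(2 : L), -2]).map w.1.embedding)))).symm
    rw [hγ, integral_comp_conj_transport _ _ e _ he ν f (⟨circleDiagonal 2 ![z * Circle.exp ψ, z * Circle.exp (-ψ)], circleDiagonal_mem_archLocal_diagonal L 2 ![(2 : L), -2] w _⟩ : ↥(unitaryGroupOfForm (starRingEnd ℂ) ((Matrix.diagonal ![(2 : L), -2]).map w.1.embedding)))]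
  have h := hodd z FD hFD hfP hfPc k
  rw [← hFF] at h
  have hit := iterate_casimirD_comp_cayley_eq ΩD ΩJ hΩD hΩJ hf hfc k
  simp only [hit, cayley_conj_smul_one] at h
  exact h

end Heads

end UnitaryGroup

end Literature.NumberTheory.Automorphic

end
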